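import Summits.QuantumFields.YangMills.Theorems.BalabanUVNodesN27AtRecord12Home
import Summits.QuantumFields.YangMills.Theorems.BalabanUVNodesN21ShellWeightKnit

/-!
# YM-DAG node N21 (= NE7c) AT THE STAGE-12 SPINE-CARRIER HOME `YMDAG.UVSplit.SRec₁₂ cr`: THE WEIGHT LETTER `S.Wsh` IS N21's OWN OUTPUT —
# no other K5 stub reads it (N20 reads `W`; N27x reads `l₀ vol K₀ T A B`; the N19′ edge reads `l₀ vol T Bad A shA B shB`), so a spine reading can be
# RE-WEIGHTED by whatever summable weight NE7c produces, and the composite knit at the homes (dag-n27-c XXVII `spine_rec12C_of_homes₁₂`) takes N21 in the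
# ∃-WEIGHT CURRENCY «for every admissible Stage-12 tuple, SOME weight `Wsh` with `ShellWeightBound (cr …) … Wsh`» with the conclusion `Spine ₁₂C` UNCHANGED

Track A of `YM-PLAN.md` (cell `pub-ymgap`, HUMAN RULING D-0062), node **N21**; R134 fan-out seat `pub-ymgap-dag-n21-d` (s2 = BY-NAME KNIT at the record),
generation 3, module 9.  THEOREMS ONLY: 0 `def`, 0 `sorry`, standard axioms; COUNT-NEUTRAL; `--supports` the K3′ item `SpineGivenEndpointR12` (rev 15,
stmt-QuantumFields-19908; dag-ref-H ids of record, pub-ymgap INBOX l.13871).  `N`-generic, NO Theses import (restate-immune).  Imports dag-n27-c's XXVII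
`BalabanUVNodesN27AtRecord12Home` (p467572: `spine_rec12C_of_homes₁₂` over dag-n20-d's `SRec₁₂` p466448 and dag-n22-e's `RRec₁₂` p466281) and n21-a's file 1
`BalabanUVNodesN21ShellWeightKnit` (p408928: `shellWeightBound_mono`).  Restates nothing; cites by name.

WHY.  Every N21 module of this lineage concludes NE7c at explicit carriers in the shape `∃ C ≥ 0, ShellWeightBound l₀ T A B shA shB (K ↦ C·ϑ^K)` (modules 5–8:
`…N21AtKeyedRateHome{,U2,Const}`, `…N21AtRRec12`; likewise the NE7c swarm's `Spine/NE7c/LiveFactorTower*`: `∃ c, … ∧ ∃ Wsh, ShellWeightBound …`) — the weight is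
PRODUCED inside the proof from THE END's letters, while the K5 stub `S_N21 (SRec₁₂ cr)` (= the BC3 skeleton's `KeyedShellWeight cr`, dag-n20-d's `s_N21_sRec₁₂_iff`)
reads the weight slot `(cr F θ hP g₀ os).Wsh` OF THE READING.  The junction is NOT an obligation on whoever types `cr`: §2 shows that re-weighting a reading
(`cr ↦ fun F θ hP g₀ os ↦ { cr F θ hP g₀ os with Wsh := w F θ hP g₀ os }`) leaves N20, N27x and the home-keyed N19′ edge untouched, §3 chooses the weight from any
∃-weight N21 certificate, and §4 is dag-n27-c's composite knit with `h21` REPLACED by the ∃-weight form.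

WHAT IS PROVED ([folklore] ∕ [bookkeeping]; each step ONE application BY NAME or definitional).
* §1 `s_N21_sRec₁₂_of_le_weight` — a reading whose weight slot is summable and DOMINATES some shell-weight bound at every admissible tuple carries
  `S_N21 (SRec₁₂ cr)` (`shellWeightBound_mono` + `s_N21_sRec₁₂_iff`); `s_N21_sRec₁₂_of_le_geometric` (geometric majorant read against a geometric slot).
* §2 RE-WEIGHTING IS INVISIBLE TO THE OTHER K5 STUBS: `s_N20_sRec₁₂_reweight_iff` · `s_N27x_sRec₁₂_reweight_iff` · `s_N19_sRec₁₂_reweight_iff` · `coreEdge₁₂_reweight`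
  (dag-n27-c's home-keyed `h19` shape) · `s_N21_sRec₁₂_reweight_iff_forall` (N21 at the re-weighted reading IS `ShellWeightBound (cr …) … (w …)` at every admissible tuple).
* §3 `exists_reweight_s_N21_sRec₁₂` — from «∀ admissible θ with provisos, ∀ g₀ os, ∃ Wsh, ShellWeightBound (cr F θ hP g₀ os) … Wsh» SOME re-weighting `w` with
  `S_N21 (SRec₁₂ (re-weighted cr))` (classical choice per tuple).
* §4 `spine_rec12C_of_homes₁₂_existsShellWeight` — XXVII's `spine_rec12C_of_homes₁₂` (six rate stubs at `RRec₁₂ 𝔯`, `S_N27x`, `S_N20` at `SRec₁₂ cr`, the home-keyed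
  N19′ edge) with `h21 : S_N21 (SRec₁₂ cr)` REPLACED by the ∃-weight certificate ⇒ `Spine ₁₂C`; `spine_rec12C_of_homes₁₂_faces_existsShellWeight` (the θ-indexed faces form).

HONEST FRAMING (binding).  Bookkeeping by name: every K4 ∕ K5 stub and the N19′ edge are HYPOTHESES with NO producer at any record today (0∕1); the readings `cr`, `𝔯`
are PARAMETERS (no reading of Bałaban's dressed two-run expansion exists in the tree); nothing of Bałaban's asserted; NE7 ∕ NE7b ∕ NE7c NOT PRINTED for d = 4 and NOT
PROVED; **N21 NOT discharged**, N27 NOT discharged, K3′ NOT claimed; typed 28∕28, discharged count untouched; one finite four-torus programme at fixed `ε` — NOT ℝ⁴,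
NOT infinite volume, NOT OS, NOT a mass gap, NOT Clay.  No decl below carries a cite tag.
-/

set_option autoImplicit false

open Finset

namespace Summit.QuantumFields.YangMills.Theorems.N21AtSRec12Weight

open Literature.MathematicalPhysics.QuantumFieldTheory.Balaban1983to89
open Literature.MathematicalPhysics.QuantumFieldTheory.Balaban1983to89.T4Continuum (T4Family ULoop)
open T4WeightBudget (RelWeightBound)
open T4IndicatorShell (ShellWeightBound)
open Summit.QuantumFields.BalabanUV.T4Continuum.Spine
open YMDAG.UVSplit
open Node00 (Stage12Params datumOfRecord₁₂ IsRecordOfRecord₁₂C IsDatumOfRecord₁₂C)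
open BalabanUVNodesN27SpineRecord (spine_rec12C_of_homes₁₂ spine_rec12C_of_homes₁₂_faces)

variable {N : ℕ} [NeZero N] (cr : SpineReading₁₂ N)

/-! ## §1 A dominating summable weight slot carries the stub -/

/-- **A READING WHOSE WEIGHT SLOT DOMINATES A SHELL-WEIGHT BOUND CARRIES `S_N21 (SRec₁₂ cr)`.**  If at every admissible Stage-12 tuple with provisos and every
`(g₀, os)` SOME weight `Wsh` has `ShellWeightBound (cr …) … Wsh` with `Wsh ≤ (cr …).Wsh` pointwise and the slot `(cr …).Wsh` summable, then the K5 stub holds at the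
reading (`shellWeightBound_mono`, `s_N21_sRec₁₂_iff`).  HYPOTHESES only; NE7c NOT proved. [folklore] -/
theorem s_N21_sRec₁₂_of_le_weight
    (h : ∀ (F : T4Family) (θ : Stage12Params F N) (hP : θ.Provisos₁₂ F N), θ.Admissible F N → ∀ (g₀ : ℕ → ℝ) (os : List (ULoop F)),
      Summable (cr F θ hP g₀ os).Wsh ∧ ∃ Wsh : ℕ → ℝ,
        ShellWeightBound (cr F θ hP g₀ os).l₀ (cr F θ hP g₀ os).T (cr F θ hP g₀ os).A (cr F θ hP g₀ os).B (cr F θ hP g₀ os).shA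
          (cr F θ hP g₀ os).shB Wsh ∧ ∀ K, Wsh K ≤ (cr F θ hP g₀ os).Wsh K) :
    S_N21 (SRec₁₂ cr) := by
  refine (s_N21_sRec₁₂_iff cr).2 fun F θ hP hθ g₀ os => ?_
  obtain ⟨hsum, Wsh, hSW, hle⟩ := h F θ hP hθ g₀ os
  exact shellWeightBound_mono hSW hle hsum

/-- **… IN PARTICULAR FOR A GEOMETRIC SLOT**: if the reading's weight slot IS `K ↦ c·ϑ^K` (`0 ≤ ϑ < 1`) at every admissible tuple and some shell-weight bound there has
weights `≤ c·ϑ^K`, the stub holds (`shellWeightBound_of_le_geometric`). [folklore] -/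
theorem s_N21_sRec₁₂_of_le_geometric
    (h : ∀ (F : T4Family) (θ : Stage12Params F N) (hP : θ.Provisos₁₂ F N), θ.Admissible F N → ∀ (g₀ : ℕ → ℝ) (os : List (ULoop F)),
      ∃ c ϑ : ℝ, 0 ≤ ϑ ∧ ϑ < 1 ∧ (cr F θ hP g₀ os).Wsh = (fun K => c * ϑ ^ K) ∧ ∃ Wsh : ℕ → ℝ,
        ShellWeightBound (cr F θ hP g₀ os).l₀ (cr F θ hP g₀ os).T (cr F θ hP g₀ os).A (cr F θ hP g₀ os).B (cr F θ hP g₀ os).shA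
          (cr F θ hP g₀ os).shB Wsh ∧ ∀ K, Wsh K ≤ c * ϑ ^ K) :
    S_N21 (SRec₁₂ cr) := by
  refine (s_N21_sRec₁₂_iff cr).2 fun F θ hP hθ g₀ os => ?_
  obtain ⟨c, ϑ, h0, h1, hslot, Wsh, hSW, hle⟩ := h F θ hP hθ g₀ os
  rw [hslot]
  exact shellWeightBound_of_le_geometric hSW h0 h1 hle

/-! ## §2 Re-weighting a reading is invisible to N20, N27x and the N19′ edge -/

section Reweight

variable (w : (F : T4Family) → (θ : Stage12Params F N) → θ.Provisos₁₂ F N → (ℕ → ℝ) → List (ULoop F) → ℕ → ℝ)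

/-- **N21 AT THE RE-WEIGHTED READING** `fun F θ hP g₀ os ↦ { cr F θ hP g₀ os with Wsh := w F θ hP g₀ os }` IS «`ShellWeightBound (cr …) … (w …)` at every admissible
Stage-12 tuple with provisos» (`s_N21_sRec₁₂_iff`; the other fields are the reading's). [bookkeeping] -/
theorem s_N21_sRec₁₂_reweight_iff_forall :
    S_N21 (SRec₁₂ fun F θ hP g₀ os => { cr F θ hP g₀ os with Wsh := w F θ hP g₀ os }) ↔
      ∀ (F : T4Family) (θ : Stage12Params F N) (hP : θ.Provisos₁₂ F N), θ.Admissible F N → ∀ (g₀ : ℕ → ℝ) (os : List (ULoop F)),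
        ShellWeightBound (cr F θ hP g₀ os).l₀ (cr F θ hP g₀ os).T (cr F θ hP g₀ os).A (cr F θ hP g₀ os).B (cr F θ hP g₀ os).shA
          (cr F θ hP g₀ os).shB (w F θ hP g₀ os) :=
  s_N21_sRec₁₂_iff _

/-- **RE-WEIGHTING IS INVISIBLE TO N20** (`RelWeightBound` reads `l₀ T A B Bad W`). [bookkeeping] -/
theorem s_N20_sRec₁₂_reweight_iff :
    S_N20 (SRec₁₂ fun F θ hP g₀ os => { cr F θ hP g₀ os with Wsh := w F θ hP g₀ os }) ↔ S_N20 (SRec₁₂ cr) := by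
  rw [s_N20_sRec₁₂_iff, s_N20_sRec₁₂_iff]

/-- **RE-WEIGHTING IS INVISIBLE TO N27x** (positivity of `l₀`, `vol` and the E1∕E2 dictionary read `l₀ vol K₀ T A B`): at every record pair the re-weighted bundle is
pinned exactly when the original is, with the same extraction data (`ForSmallCouplings.mono` per string). [bookkeeping] -/
theorem s_N27x_sRec₁₂_reweight_iff (Rec : RecordPred N) :
    S_N27x Rec (SRec₁₂ fun F θ hP g₀ os => { cr F θ hP g₀ os with Wsh := w F θ hP g₀ os }) ↔ S_N27x Rec (SRec₁₂ cr) := by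
  constructor
  · intro h F D w' hR hB hEnd
    refine (h F D w' hR hB hEnd).mono fun g₀ hg os => ?_
    obtain ⟨S, ⟨θ, hP, hθ, hD, rfl⟩, hl₀, hvol, hZA, hZB⟩ := hg os
    exact ⟨cr F θ hP g₀ os, ⟨θ, hP, hθ, hD, rfl⟩, hl₀, hvol, hZA, hZB⟩
  · intro h F D w' hR hB hEnd
    refine (h F D w' hR hB hEnd).mono fun g₀ hg os => ?_
    obtain ⟨S, ⟨θ, hP, hθ, hD, rfl⟩, hl₀, hvol, hZA, hZB⟩ := hg os
    exact ⟨{ cr F θ hP g₀ os with Wsh := w F θ hP g₀ os }, ⟨θ, hP, hθ, hD, rfl⟩, hl₀, hvol, hZA, hZB⟩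

/-- **RE-WEIGHTING IS INVISIBLE TO N19 AS THE EDGE** (`Spine.NE7.Core` on the shell-free cores reads `l₀ vol T Bad A shA B shB δ`), for every inputs predicate. [bookkeeping] -/
theorem s_N19_sRec₁₂_reweight_iff (Inputs : InputsPred N) :
    S_N19 (SRec₁₂ fun F θ hP g₀ os => { cr F θ hP g₀ os with Wsh := w F θ hP g₀ os }) Inputs ↔ S_N19 (SRec₁₂ cr) Inputs := by
  rw [s_N19_sRec₁₂_iff, s_N19_sRec₁₂_iff]

/-- **RE-WEIGHTING IS INVISIBLE TO THE HOME-KEYED N19′ EDGE** (dag-n27-c XXVII's `h19` shape: at every admissible Stage-12 tuple, every datum key of its own datum and every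
run length, the six rates at the canonical rate bundle give SOME summable `δ` carrying `Spine.NE7.Core` on the shell-free cores of the spine bundle). [bookkeeping] -/
theorem coreEdge₁₂_reweight (𝔯 : RateReading₁₂ N)
    (h19 : ∀ (F : T4Family) (θ : Stage12Params F N) (hP : θ.Provisos₁₂ F N), θ.Admissible F N → ∀ (g₀ : ℕ → ℝ) (os : List (ULoop F))
      (h : IsDatumOfRecord₁₂C F N (datumOfRecord₁₂ F N θ hP)) (k : ℕ),
      RatesAt (datumOfRecord₁₂ F N θ hP) (rateCarriersOfRecord₁₂ 𝔯 F h.params h.provisos g₀ os k) → letI := (cr F θ hP g₀ os).dec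
        ∃ δ : ℕ → ℝ, NE7.Core (cr F θ hP g₀ os).l₀ (cr F θ hP g₀ os).vol (cr F θ hP g₀ os).T (cr F θ hP g₀ os).Bad
          (fun K t τ => (cr F θ hP g₀ os).A K t τ - (cr F θ hP g₀ os).shA K t τ) (fun K t τ => (cr F θ hP g₀ os).B K t τ - (cr F θ hP g₀ os).shB K t τ) δ ∧
          Summable δ)
    (F : T4Family) (θ : Stage12Params F N) (hP : θ.Provisos₁₂ F N) (hθ : θ.Admissible F N) (g₀ : ℕ → ℝ) (os : List (ULoop F))
    (h : IsDatumOfRecord₁₂C F N (datumOfRecord₁₂ F N θ hP)) (k : ℕ)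
    (hr : RatesAt (datumOfRecord₁₂ F N θ hP) (rateCarriersOfRecord₁₂ 𝔯 F h.params h.provisos g₀ os k)) :
    letI S : SpineCarriers := { cr F θ hP g₀ os with Wsh := w F θ hP g₀ os }
    letI := S.dec
    ∃ δ : ℕ → ℝ, NE7.Core S.l₀ S.vol S.T S.Bad (fun K t τ => S.A K t τ - S.shA K t τ) (fun K t τ => S.B K t τ - S.shB K t τ) δ ∧ Summable δ :=
  h19 F θ hP hθ g₀ os h k hr

end Reweight

/-! ## §3 Choosing the weight: from an ∃-weight certificate to the stub at a re-weighted reading -/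

/-- **THE WEIGHT CAN BE CHOSEN**: if at every admissible Stage-12 tuple with provisos and every `(g₀, os)` SOME weight `Wsh` has `ShellWeightBound (cr …) … Wsh` (the output
currency of every N21 module at explicit carriers and of the NE7c swarm), then SOME re-weighting `w` of the reading carries the K5 stub `S_N21 (SRec₁₂ (re-weighted cr))`
(classical choice per tuple; `s_N21_sRec₁₂_iff`).  HYPOTHESIS only; NE7c NOT proved. [folklore] -/
theorem exists_reweight_s_N21_sRec₁₂
    (hW : ∀ (F : T4Family) (θ : Stage12Params F N) (hP : θ.Provisos₁₂ F N), θ.Admissible F N → ∀ (g₀ : ℕ → ℝ) (os : List (ULoop F)),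
      ∃ Wsh : ℕ → ℝ, ShellWeightBound (cr F θ hP g₀ os).l₀ (cr F θ hP g₀ os).T (cr F θ hP g₀ os).A (cr F θ hP g₀ os).B (cr F θ hP g₀ os).shA
        (cr F θ hP g₀ os).shB Wsh) :
    ∃ w : (F : T4Family) → (θ : Stage12Params F N) → θ.Provisos₁₂ F N → (ℕ → ℝ) → List (ULoop F) → ℕ → ℝ,
      S_N21 (SRec₁₂ fun F θ hP g₀ os => { cr F θ hP g₀ os with Wsh := w F θ hP g₀ os }) := by
  classical
  refine ⟨fun F θ hP g₀ os => if hθ : θ.Admissible F N then (hW F θ hP hθ g₀ os).choose else (cr F θ hP g₀ os).Wsh, ?_⟩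
  refine (s_N21_sRec₁₂_reweight_iff_forall cr _).2 fun F θ hP hθ g₀ os => ?_
  rw [dif_pos hθ]
  exact (hW F θ hP hθ g₀ os).choose_spec

/-! ## §4 The composite knit at the homes with N21 in the ∃-weight currency -/

/-- **N27 = B5 AT THE STAGE-12 RECORD FROM THE HOMES, N21 SUPPLIED AS AN ∃-WEIGHT CERTIFICATE.**  dag-n27-c XXVII's `spine_rec12C_of_homes₁₂` — the six K4 stubs at
`RRec₁₂ 𝔯`, `S_N27x ₁₂C (SRec₁₂ cr)`, `S_N20 (SRec₁₂ cr)` and the home-keyed N19′ edge `h19` — with `h21 : S_N21 (SRec₁₂ cr)` REPLACED by «for every admissible Stage-12 tuple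
with provisos and every `(g₀, os)`, SOME weight `Wsh` with `ShellWeightBound (cr …) … Wsh`»: the reading is re-weighted by §3, the other binders transferred by §2, and the
conclusion `Spine ₁₂C` does not mention the reading.  Every binder a HYPOTHESIS (0∕1 today); N21 ∕ N27 NOT discharged; K3′ NOT claimed. [bookkeeping] -/
theorem spine_rec12C_of_homes₁₂_existsShellWeight (𝔯 : RateReading₁₂ N) (h14 : S_N14 (RRec₁₂ 𝔯)) (h15 : S_N15 (RRec₁₂ 𝔯)) (h16 : S_N16 (RRec₁₂ 𝔯))
    (h17 : S_N17 (RRec₁₂ 𝔯)) (h18 : S_N18 (RRec₁₂ 𝔯)) (h22 : S_N22 (RRec₁₂ 𝔯)) (hx' : S_N27x (fun F D w => IsRecordOfRecord₁₂C F N D w) (SRec₁₂ cr))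
    (h20 : S_N20 (SRec₁₂ cr))
    (hW : ∀ (F : T4Family) (θ : Stage12Params F N) (hP : θ.Provisos₁₂ F N), θ.Admissible F N → ∀ (g₀ : ℕ → ℝ) (os : List (ULoop F)),
      ∃ Wsh : ℕ → ℝ, ShellWeightBound (cr F θ hP g₀ os).l₀ (cr F θ hP g₀ os).T (cr F θ hP g₀ os).A (cr F θ hP g₀ os).B (cr F θ hP g₀ os).shA
        (cr F θ hP g₀ os).shB Wsh)
    (h19 : ∀ (F : T4Family) (θ : Stage12Params F N) (hP : θ.Provisos₁₂ F N), θ.Admissible F N → ∀ (g₀ : ℕ → ℝ) (os : List (ULoop F))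
      (h : IsDatumOfRecord₁₂C F N (datumOfRecord₁₂ F N θ hP)) (k : ℕ),
      RatesAt (datumOfRecord₁₂ F N θ hP) (rateCarriersOfRecord₁₂ 𝔯 F h.params h.provisos g₀ os k) → letI := (cr F θ hP g₀ os).dec
        ∃ δ : ℕ → ℝ, NE7.Core (cr F θ hP g₀ os).l₀ (cr F θ hP g₀ os).vol (cr F θ hP g₀ os).T (cr F θ hP g₀ os).Bad
          (fun K t τ => (cr F θ hP g₀ os).A K t τ - (cr F θ hP g₀ os).shA K t τ) (fun K t τ => (cr F θ hP g₀ os).B K t τ - (cr F θ hP g₀ os).shB K t τ) δ ∧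
          Summable δ) :
    Spine (N := N) fun F D w => IsRecordOfRecord₁₂C F N D w := by
  obtain ⟨w, h21⟩ := exists_reweight_s_N21_sRec₁₂ cr hW
  exact spine_rec12C_of_homes₁₂ (fun F θ hP g₀ os => { cr F θ hP g₀ os with Wsh := w F θ hP g₀ os }) 𝔯 h14 h15 h16 h17 h18 h22
    ((s_N27x_sRec₁₂_reweight_iff cr w _).2 hx') ((s_N20_sRec₁₂_reweight_iff cr w).2 h20) h21 (coreEdge₁₂_reweight cr w 𝔯 h19)

/-- **THE SAME WITH THE SPINE-SIDE STUBS READ THROUGH THE HOME's FACES** (XXVII `spine_rec12C_of_homes₁₂_faces` with `h21` in the ∃-weight currency): N27x's unconditional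
θ-form, N20 `RelWeightBound (cr …)` and «∃ Wsh, ShellWeightBound (cr …) … Wsh» at every admissible Stage-12 tuple with provisos, the six rate stubs and the home-keyed edge ⇒
`Spine ₁₂C`. [bookkeeping] -/
theorem spine_rec12C_of_homes₁₂_faces_existsShellWeight (𝔯 : RateReading₁₂ N) (h14 : S_N14 (RRec₁₂ 𝔯)) (h15 : S_N15 (RRec₁₂ 𝔯)) (h16 : S_N16 (RRec₁₂ 𝔯))
    (h17 : S_N17 (RRec₁₂ 𝔯)) (h18 : S_N18 (RRec₁₂ 𝔯)) (h22 : S_N22 (RRec₁₂ 𝔯))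
    (hx : ∀ (F : T4Family) (θ : Stage12Params F N) (hP : θ.Provisos₁₂ F N), θ.Admissible F N → ∀ (g₀ : ℕ → ℝ) (os : List (ULoop F)),
      0 < (cr F θ hP g₀ os).l₀ ∧ 0 < (cr F θ hP g₀ os).vol ∧
        (∀ (K : ℕ) (t : ℝ), |t| ≤ (cr F θ hP g₀ os).l₀ →
          T4GenFunBounds.schemeZ ((datumOfRecord₁₂ F N θ hP).scheme g₀) os ((cr F θ hP g₀ os).K₀ + K) t =
            ∑ τ ∈ (cr F θ hP g₀ os).T K, (cr F θ hP g₀ os).A K t τ) ∧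
        (∀ (K : ℕ) (t : ℝ), |t| ≤ (cr F θ hP g₀ os).l₀ →
          T4GenFunBounds.schemeZ ((datumOfRecord₁₂ F N θ hP).scheme g₀) os ((cr F θ hP g₀ os).K₀ + K + 1) t =
            ∑ τ ∈ (cr F θ hP g₀ os).T K, (cr F θ hP g₀ os).B K t τ))
    (h20 : ∀ (F : T4Family) (θ : Stage12Params F N) (hP : θ.Provisos₁₂ F N), θ.Admissible F N → ∀ (g₀ : ℕ → ℝ) (os : List (ULoop F)),
      RelWeightBound (cr F θ hP g₀ os).l₀ (cr F θ hP g₀ os).T (cr F θ hP g₀ os).A (cr F θ hP g₀ os).B (cr F θ hP g₀ os).Bad (cr F θ hP g₀ os).W)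
    (hW : ∀ (F : T4Family) (θ : Stage12Params F N) (hP : θ.Provisos₁₂ F N), θ.Admissible F N → ∀ (g₀ : ℕ → ℝ) (os : List (ULoop F)),
      ∃ Wsh : ℕ → ℝ, ShellWeightBound (cr F θ hP g₀ os).l₀ (cr F θ hP g₀ os).T (cr F θ hP g₀ os).A (cr F θ hP g₀ os).B (cr F θ hP g₀ os).shA
        (cr F θ hP g₀ os).shB Wsh)
    (h19 : ∀ (F : T4Family) (θ : Stage12Params F N) (hP : θ.Provisos₁₂ F N), θ.Admissible F N → ∀ (g₀ : ℕ → ℝ) (os : List (ULoop F))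
      (h : IsDatumOfRecord₁₂C F N (datumOfRecord₁₂ F N θ hP)) (k : ℕ),
      RatesAt (datumOfRecord₁₂ F N θ hP) (rateCarriersOfRecord₁₂ 𝔯 F h.params h.provisos g₀ os k) → letI := (cr F θ hP g₀ os).dec
        ∃ δ : ℕ → ℝ, NE7.Core (cr F θ hP g₀ os).l₀ (cr F θ hP g₀ os).vol (cr F θ hP g₀ os).T (cr F θ hP g₀ os).Bad
          (fun K t τ => (cr F θ hP g₀ os).A K t τ - (cr F θ hP g₀ os).shA K t τ) (fun K t τ => (cr F θ hP g₀ os).B K t τ - (cr F θ hP g₀ os).shB K t τ) δ ∧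
          Summable δ) :
    Spine (N := N) fun F D w => IsRecordOfRecord₁₂C F N D w :=
  spine_rec12C_of_homes₁₂_existsShellWeight cr 𝔯 h14 h15 h16 h17 h18 h22 (s_N27x_sRec₁₂_of cr hx) ((s_N20_sRec₁₂_iff cr).2 h20) hW h19

end Summit.QuantumFields.YangMills.Theorems.N21AtSRec12Weight
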